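import Literature.Analysis.FluidPDE.TaoAveragedRotationAveragingProofs
import Literature.Analysis.FluidPDE.TaoAveragedSymbolExtractionAt
import HarnessLib

/-!
# Tao 2016, §3.6 (last paragraph): the plane-wave synthesis of a joint weight for a GENERAL
# bounded measurable single-scale weight (in particular for `B_{η,ρ,0;ξ}` about any base triple)

T. Tao, *Finite time blowup for an averaged three-dimensional Navier–Stokes equation*,
J. Amer. Math. Soc. **29** (2016), 601–674 = arXiv:1402.0290v3, §3.6, p. 18 ("By a Fourier
expansion and another smooth truncation … Inserting this expansion into (3.16), we obtain the
desired expansion (3.15)"). Sequel of `TaoAveragedRotationAveragingProofs.lean`, which proves the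
named fact `planeWaveSynthesis` for the single-scale weight `φ(|ξ₁-ξ₁⁰|/ε₀²) η(|ξ₁|,|ξ₂|,|ξ₃|)` of
(3.9) at Tao's normalisation `xi0`; as its design notes record, "the weight `φ η` of (3.9)/(3.13)
is only used through `|φ η| ≤ 1` and its measurability". HONEST FRAMING (cell harvest/h2-tao-ladder,
TAO-LADDER rung M_1 — MODEL statements about Tao's averaged equation): this file re-runs the last
twelve lemmas of that proof for an ARBITRARY measurable weight `w : ℝ³ × ℝ³ → ℂ` with `|w| ≤ 1`,
REUSING the weight-independent datum `PlaneWave.datum` verbatim, and specialises to the weight of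
`B_{η,ρ,0;ξ}` about a general base triple `ξ` (`TaoAveragedSymbolExtractionAt.lean`) — groundwork for
the rung-1 crux `SingleScaleNoDilAt`. Nothing here concerns the true Navier–Stokes equations.

* `ComplexAveragingDatum.freqSideIntegrandW w`, `jointWeightAverageW μ₀ E w F` — the two sides of
  the synthesis identity with a general weight; `freqSideIntegrandAt_eq_W`, `singleScaleWeightAtC`
  (the weight of `B_{η,ρ,0;ξ}` as a complex weight, measurable, of modulus `≤ 1`);
* `PlaneWave.KW`, `JW`, `HW` and the lemmas `measurable_KW` … `integral_freqSideIntegrandW_datum` —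
  copies of `PlaneWave.K`, `J`, `H`, … with `wt ε₀ ↦ w`;
* **`planeWaveSynthesisW`** — for every finite `μ₀`, measurable rotation family `E`, smooth
  compactly supported joint weight `F` and measurable `w` with `|w| ≤ 1`, the datum
  `PlaneWave.datum μ₀ E F` (λ ≡ 1) satisfies
  `∫_Ω freqSideIntegrandW w = jointWeightAverageW μ₀ E w F` on `L¹ ∩ L²` frequency functions;
  **`planeWaveSynthesisAt`** — the instance for the weight of `B_{η,ρ,0;ξ}`.

## References

* T. Tao, J. Amer. Math. Soc. 29 (2016), 601–674, arXiv:1402.0290v3, §3.5 (3.13), §3.6 p. 18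
  ((3.15)–(3.16)), Def. 3.4 (3.5), Remark 3.5 p. 20. Key `Tao2016AveragedNS`.
-/

noncomputable section

open MeasureTheory Set Filter FourierTransform Metric
open scoped ENNReal NNReal SchwartzMap ComplexConjugate RealInnerProductSpace FourierTransform

namespace Literature.Analysis.FluidPDE.Tao2016

/-- Local notation for physical / frequency space `ℝ³`. -/
local notation "ℝ³" => EuclideanSpace ℝ (Fin 3)
/-- Local notation for the complexified range `ℂ³`. -/
local notation "ℂ³" => EuclideanSpace ℂ (Fin 3)

/-! ### The two sides of the synthesis identity with a general weight -/

namespace ComplexAveragingDatum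

variable (𝒟 : ComplexAveragingDatum)

/-- **The frequency-side integrand with a general weight `w`**:
`∫_{ζ₁+ζ₂+ζ₃=0} w(ζ₁,ζ₂) Λ_ζ(m_{1,ω}(ζ₁) R_{1,ω} X₁(R_{1,ω}⁻¹ζ₁), …)` (Bochner junk `0`); the tree's
`freqSideIntegrand ε₀` / `freqSideIntegrandAt ξ ε₀` are the instances for the weights of `B_{η,ρ,0}` /
`B_{η,ρ,0;ξ}`. [cite: Tao2016AveragedNS, §3.5 p. 17] -/
def freqSideIntegrandW (w : ℝ³ × ℝ³ → ℂ) (θ : 𝒟.Ω) (X₁ X₂ X₃ : ℝ³ → ℂ³) : ℂ :=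
  ∫ p : ℝ³ × ℝ³,
    w p * Λ p.1 p.2 (𝒟.slotFreq 0 θ X₁ p.1) (𝒟.slotFreq 1 θ X₂ p.2) (𝒟.slotFreq 2 θ X₃ (-p.1 - p.2))

end ComplexAveragingDatum

/-- **The weight of `B_{η,ρ,0;ξ}` as a complex weight**: `φ(|ζ₁ - ξ 0|/ε₀²) η_ξ(|ζ₁|,|ζ₂|,|ζ₃|)`.
[cite: Tao2016AveragedNS, §3.4 (3.9)] -/
def singleScaleWeightAtC (ξ : Fin 3 → ℝ³) (ε₀ : ℝ) (p : ℝ³ × ℝ³) : ℂ :=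
  ((freqCutoff (‖p.1 - ξ 0‖ / ε₀ ^ 2) * etaAt ξ ε₀ ‖p.1‖ ‖p.2‖ ‖-p.1 - p.2‖ : ℝ) : ℂ)

/-- The frequency-side integrand about `ξ` is the general-weight integrand for the weight of
`B_{η,ρ,0;ξ}` (by `rfl`). [cite: Tao2016AveragedNS, §3.5 p. 17] -/
theorem ComplexAveragingDatum.freqSideIntegrandAt_eq_W (𝒟 : ComplexAveragingDatum)
    (ξ : Fin 3 → ℝ³) (ε₀ : ℝ) (θ : 𝒟.Ω) (X₁ X₂ X₃ : ℝ³ → ℂ³) :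
    𝒟.freqSideIntegrandAt ξ ε₀ θ X₁ X₂ X₃ = 𝒟.freqSideIntegrandW (singleScaleWeightAtC ξ ε₀) θ X₁ X₂ X₃ :=
  rfl

/-- `|φ η_ξ| ≤ 1` (both cut-offs take values in `[0,1]`). [cite: Tao2016AveragedNS, §3.3 p. 16] -/
theorem norm_singleScaleWeightAtC_le_one (ξ : Fin 3 → ℝ³) (ε₀ : ℝ) (p : ℝ³ × ℝ³) :
    ‖singleScaleWeightAtC ξ ε₀ p‖ ≤ 1 := by
  unfold singleScaleWeightAtC etaAt
  rw [Complex.norm_real, Real.norm_eq_abs, abs_mul, abs_mul]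
  have h1 := freqCutoff_nonneg
  have h2 := freqCutoff_le_one
  refine mul_le_one₀ ?_ (by positivity) (mul_le_one₀ ?_ (abs_nonneg _) ?_) <;>
    · rw [abs_of_nonneg (h1 _)]
      exact h2 _

/-- The weight of `B_{η,ρ,0;ξ}` is measurable. [cite: Tao2016AveragedNS, §3.4 (3.9)] -/
theorem measurable_singleScaleWeightAtC (ξ : Fin 3 → ℝ³) (ε₀ : ℝ) :
    Measurable (singleScaleWeightAtC ξ ε₀) := by
  have hφ : Measurable freqCutoff := (contDiff_freqCutoff (n := 0)).continuous.measurable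
  have h1 : Measurable fun p : ℝ³ × ℝ³ => ‖p.1‖ := measurable_fst.norm
  have h2 : Measurable fun p : ℝ³ × ℝ³ => ‖p.2‖ := measurable_snd.norm
  have h3 : Measurable fun p : ℝ³ × ℝ³ => ‖-p.1 - p.2‖ := (measurable_fst.neg.sub measurable_snd).norm
  have hη : Measurable fun p : ℝ³ × ℝ³ => etaAt ξ ε₀ ‖p.1‖ ‖p.2‖ ‖-p.1 - p.2‖ := by
    unfold etaAt
    exact (hφ.comp (((h2.div h1).sub measurable_const).div measurable_const)).mul
      (hφ.comp (((h3.div h1).sub measurable_const).div measurable_const))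
  have hρ : Measurable fun p : ℝ³ × ℝ³ => freqCutoff (‖p.1 - ξ 0‖ / ε₀ ^ 2) :=
    hφ.comp ((measurable_fst.sub_const _).norm.div_const _)
  exact Complex.measurable_ofReal.comp (hρ.mul hη)

/-- **The frequency-side average with a joint weight `F` and a general single-scale weight `w`**
over a family of rotations `Eⱼ(ω)` and a measure `μ₀`:
`∫_V ∫∫ w(ζ₁,ζ₂) F(ω,ζ₁,ζ₂) Λ_ζ(E₁(ω) X₁(E₁(ω)⁻¹ζ₁), E₂(ω) X₂(E₂(ω)⁻¹ζ₂), E₃(ω) X₃(E₃(ω)⁻¹ζ₃)) dζ dμ₀(ω)`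
(the tree's `jointWeightAverage μ₀ E ε₀ F` is the instance `w = φ η` at `xi0`).
[cite: Tao2016AveragedNS, §3.6 (3.15)–(3.16)] -/
def jointWeightAverageW {V : Type*} [MeasurableSpace V] (μ₀ : Measure V)
    (E : Fin 3 → V → (ℝ³ ≃ₗᵢ[ℝ] ℝ³)) (w : ℝ³ × ℝ³ → ℂ) (F : V × (ℝ³ × ℝ³) → ℂ)
    (X₁ X₂ X₃ : ℝ³ → ℂ³) : ℂ :=
  ∫ ω, (∫ p : ℝ³ × ℝ³, w p * F (ω, p) *
    Λ p.1 p.2 (rotMat (E 0 ω) (X₁ ((E 0 ω).symm p.1))) (rotMat (E 1 ω) (X₂ ((E 1 ω).symm p.2)))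
      (rotMat (E 2 ω) (X₃ ((E 2 ω).symm (-p.1 - p.2))))) ∂μ₀

namespace PlaneWave

/-! ### The kernel with a general weight -/

section KernelW

variable (d : ℕ) (R : ℝ) (w : ℝ³ × ℝ³ → ℂ)

/-- The kernel `K_w(v; ξ₁, ξ₂) = w(ξ₁,ξ₂) · e^{2πi x₁(v)·ξ₁} χ(ξ₁) · e^{2πi x₂(v)·ξ₂} χ(ξ₂)` for a general weight `w`.
[cite: Tao2016AveragedNS, §3.6 p. 18] -/
def KW (d : ℕ) (R : ℝ) (w : ℝ³ × ℝ³ → ℂ) (v : Wsp d) (p : ℝ³ × ℝ³) : ℂ :=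
  w p * (pw R (x1Part d v) p.1 * pw R (x2Part d v) p.2)

/-- The kernel is jointly measurable. [folklore] -/
private theorem measurable_KW (hwm : Measurable w) : Measurable fun q : Wsp d × (ℝ³ × ℝ³) => KW d R w q.1 q.2 := by
  have h0 : Measurable fun q : Wsp d × (ℝ³ × ℝ³) => w q.2 := hwm.comp measurable_snd
  have h1 := (continuous_pw_x1Part d R).measurable
  have h2 := (continuous_pw_x2Part d R).measurable
  have h3 := h0.mul (h1.mul h2)
  exact h3

/-- `|K(v; ξ₁, ξ₂)| (|ξ₁| + |ξ₂|) ≤ 2 (R⁺ + 2)`: the kernel localises both frequencies.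
[cite: Tao2016AveragedNS, §3.6 p. 18] -/
theorem norm_KW_mul_le (hw1 : ∀ p, ‖w p‖ ≤ 1) (v : Wsp d) (p : ℝ³ × ℝ³) :
    ‖KW d R w v p‖ * (‖p.1‖ + ‖p.2‖) ≤ 2 * (max R 0 + 2) := by
  have hK : ‖KW d R w v p‖ ≤ chi R p.1 * chi R p.2 := by
    unfold KW
    rw [norm_mul, norm_mul]
    calc ‖w p‖ * (‖pw R (x1Part d v) p.1‖ * ‖pw R (x2Part d v) p.2‖)
        ≤ 1 * (chi R p.1 * chi R p.2) :=
          mul_le_mul (hw1 p) (mul_le_mul (norm_pw_le_chi R _ _) (norm_pw_le_chi R _ _)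
            (norm_nonneg _) (chi_nonneg R _)) (by positivity) zero_le_one
      _ = chi R p.1 * chi R p.2 := one_mul _
  have h1 := chi_mul_norm_le R p.1
  have h2 := chi_mul_norm_le R p.2
  have c1 := chi_le_one R p.1
  have c2 := chi_le_one R p.2
  have n1 := chi_nonneg R p.1
  have n2 := chi_nonneg R p.2
  calc ‖KW d R w v p‖ * (‖p.1‖ + ‖p.2‖) ≤ chi R p.1 * chi R p.2 * (‖p.1‖ + ‖p.2‖) :=
        mul_le_mul_of_nonneg_right hK (by positivity)
    _ = chi R p.2 * (chi R p.1 * ‖p.1‖) + chi R p.1 * (chi R p.2 * ‖p.2‖) := by ring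
    _ ≤ 1 * (max R 0 + 2) + 1 * (max R 0 + 2) := by
        gcongr
    _ = 2 * (max R 0 + 2) := by ring

/-- `|K| ≤ 1`. [folklore] -/
private theorem norm_KW_le_one (hw1 : ∀ p, ‖w p‖ ≤ 1) (v : Wsp d) (p : ℝ³ × ℝ³) : ‖KW d R w v p‖ ≤ 1 := by
  unfold KW
  rw [norm_mul, norm_mul]
  calc ‖w p‖ * (‖pw R (x1Part d v) p.1‖ * ‖pw R (x2Part d v) p.2‖) ≤ 1 * (1 * 1) :=
        mul_le_mul (hw1 p) (mul_le_mul (norm_pw_le_one R _ _) (norm_pw_le_one R _ _)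
          (norm_nonneg _) zero_le_one) (by positivity) zero_le_one
    _ = 1 := by ring

/-- **The pointwise domination** `|K(v; ξ₁, ξ₂) Λ(Y₁, Y₂, Y₃)| ≤ 2 (R⁺ + 2) |X₁| |X₂| |X₃|`.
[cite: Tao2016AveragedNS, §3.6 p. 18] -/
theorem norm_KW_mul_LamRot_le (hw1 : ∀ p, ‖w p‖ ≤ 1) {A : Type*} (S : Fin 3 → A → (ℝ³ ≃ₗᵢ[ℝ] ℝ³)) (X₁ X₂ X₃ : ℝ³ → ℂ³)
    (a : A) (v : Wsp d) (p : ℝ³ × ℝ³) :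
    ‖KW d R w v p * LamRot S X₁ X₂ X₃ a p‖ ≤ 2 * (max R 0 + 2) * normProd S X₁ X₂ X₃ a p := by
  rw [norm_mul]
  have hn := normProd_nonneg S X₁ X₂ X₃ a p
  calc ‖KW d R w v p‖ * ‖LamRot S X₁ X₂ X₃ a p‖
      ≤ ‖KW d R w v p‖ * ((‖p.1‖ + ‖p.2‖) * normProd S X₁ X₂ X₃ a p) :=
        mul_le_mul_of_nonneg_left (norm_LamRot_le S X₁ X₂ X₃ a p) (norm_nonneg _)
    _ = ‖KW d R w v p‖ * (‖p.1‖ + ‖p.2‖) * normProd S X₁ X₂ X₃ a p := by ring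
    _ ≤ 2 * (max R 0 + 2) * normProd S X₁ X₂ X₃ a p :=
        mul_le_mul_of_nonneg_right (norm_KW_mul_le d R w hw1 v p) hn


end KernelW

/-! ### The synthesis identity for a general weight -/

section IdentityW

variable {d : ℕ} (μ₀ : Measure (Fin d → ℝ³)) {E : Fin 3 → (Fin d → ℝ³) → (ℝ³ ≃ₗᵢ[ℝ] ℝ³)}
  (R : ℝ) (w : ℝ³ × ℝ³ → ℂ) {F : (Fin d → ℝ³) × (ℝ³ × ℝ³) → ℂ} {X₁ X₂ X₃ : ℝ³ → ℂ³}

/-- The `p`-integral `J(θ) = ∫ K(v; ξ₁, ξ₂) Λ(Y₁, Y₂, Y₃) dξ₁dξ₂` at `θ = (ω, v)`.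
[cite: Tao2016AveragedNS, §3.6 p. 18] -/
def JW (R : ℝ) (w : ℝ³ × ℝ³ → ℂ) (E : Fin 3 → (Fin d → ℝ³) → (ℝ³ ≃ₗᵢ[ℝ] ℝ³)) (X₁ X₂ X₃ : ℝ³ → ℂ³)
    (θ : (Fin d → ℝ³) × Wsp d) : ℂ :=
  ∫ p : ℝ³ × ℝ³, KW d R w θ.2 p * LamRot E X₁ X₂ X₃ θ.1 p

/-- **Step A**: the frequency-side integrand of the datum is `c₀(θ) J(θ)` (trilinearity of `Λ`).
[cite: Tao2016AveragedNS, §3.6 p. 18] -/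
theorem freqSideIntegrandW_datum [IsFiniteMeasure μ₀] (hE : IsRotationFamily E)
    (hF : ContDiff ℝ ((⊤ : ℕ∞) : WithTop ℕ∞) F) (hFc : HasCompactSupport F)
    (θ : (datum μ₀ hE hF hFc).Ω) (X₁ X₂ X₃ : ℝ³ → ℂ³) :
    (datum μ₀ hE hF hFc).freqSideIntegrandW w θ X₁ X₂ X₃ =
      c0 F θ * JW (Rad hFc) w E X₁ X₂ X₃ θ := by
  unfold ComplexAveragingDatum.freqSideIntegrandW ComplexAveragingDatum.slotFreq JW
  rw [← integral_const_mul]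
  refine integral_congr_ae (Eventually.of_forall fun p => ?_)
  change w p *
      Λ p.1 p.2 (symb (Rad hFc) F 0 θ p.1 • rotMat (E 0 θ.1) (X₁ ((E 0 θ.1).symm p.1)))
        (symb (Rad hFc) F 1 θ p.2 • rotMat (E 1 θ.1) (X₂ ((E 1 θ.1).symm p.2)))
        (symb (Rad hFc) F 2 θ (-p.1 - p.2) • rotMat (E 2 θ.1) (X₃ ((E 2 θ.1).symm (-p.1 - p.2)))) =
    c0 F θ * (KW d (Rad hFc) w θ.2 p * LamRot E X₁ X₂ X₃ θ.1 p)
  rw [Λ_smul_smul_smul, symb_zero, symb_one, symb_two]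
  unfold KW LamRot
  ring

/-- **Integrability of `K Λ` on `Ω × ℝ⁶`** (Tonelli and the trilinear bound).
[cite: Tao2016AveragedNS, §3.6 p. 18] -/
theorem integrable_KWLam (hwm : Measurable w) (hw1 : ∀ p, ‖w p‖ ≤ 1) [IsFiniteMeasure μ₀]
    (hE : IsRotationFamily E)
    (hF : ContDiff ℝ ((⊤ : ℕ∞) : WithTop ℕ∞) F) (hFc : HasCompactSupport F)
    (h₁ : FreqIntegrable X₁) (h₂ : FreqIntegrable X₂) (h₃ : FreqIntegrable X₃) :
    Integrable (fun q : ((Fin d → ℝ³) × Wsp d) × (ℝ³ × ℝ³) =>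
        KW d R w q.1.2 q.2 * LamRot (SΩ E) X₁ X₂ X₃ q.1 q.2)
      ((μ₀.prod (nu F)).prod ((volume : Measure ℝ³).prod volume)) := by
  haveI := isFiniteMeasure_nu hF hFc
  set κ : Measure ((Fin d → ℝ³) × Wsp d) := μ₀.prod (nu F) with hκ
  have hS := measurable_SΩ hE
  have hLam := aestronglyMeasurable_LamRot κ hS h₁.1.1 h₂.1.1 h₃.1.1
  have hK1 : Measurable fun q : ((Fin d → ℝ³) × Wsp d) × (ℝ³ × ℝ³) => (q.1.2, q.2) :=
    (measurable_snd.comp measurable_fst).prodMk measurable_snd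
  have hKm := (measurable_KW d R w hwm).comp hK1
  have hKm' : AEStronglyMeasurable (fun q : ((Fin d → ℝ³) × Wsp d) × (ℝ³ × ℝ³) => KW d R w q.1.2 q.2)
      (κ.prod ((volume : Measure ℝ³).prod volume)) := hKm.aestronglyMeasurable
  refine ⟨hKm'.mul hLam, ?_⟩
  rw [hasFiniteIntegral_iff_enorm]
  have hnp := aestronglyMeasurable_normProd κ hS h₁.1.1 h₂.1.1 h₃.1.1
  set ρ2 : ℝ := 2 * (max R 0 + 2) with hρ2
  have hρ2nn : 0 ≤ ρ2 := by rw [hρ2]; positivity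
  have hpt : ∀ q : ((Fin d → ℝ³) × Wsp d) × (ℝ³ × ℝ³),
      ‖KW d R w q.1.2 q.2 * LamRot (SΩ E) X₁ X₂ X₃ q.1 q.2‖ₑ ≤
        ENNReal.ofReal ρ2 * ‖normProd (SΩ E) X₁ X₂ X₃ q.1 q.2‖ₑ := fun q => by
    rw [← ofReal_norm, Real.enorm_eq_ofReal (normProd_nonneg _ _ _ _ _ _), ← ENNReal.ofReal_mul hρ2nn]
    exact ENNReal.ofReal_le_ofReal (norm_KW_mul_LamRot_le d R w hw1 (SΩ E) X₁ X₂ X₃ q.1 q.1.2 q.2)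
  have hinner : ∀ θ : (Fin d → ℝ³) × Wsp d,
      ∫⁻ p, ‖normProd (SΩ E) X₁ X₂ X₃ θ p‖ₑ ∂((volume : Measure ℝ³).prod volume) ≤
        tripleBound X₁ X₂ X₃ := fun θ => lintegral_normProd_le h₁.1.1 h₂.1.1 h₃.1.1 θ
  calc ∫⁻ q, ‖KW d R w q.1.2 q.2 * LamRot (SΩ E) X₁ X₂ X₃ q.1 q.2‖ₑ
        ∂(κ.prod ((volume : Measure ℝ³).prod volume))
      ≤ ∫⁻ q, ENNReal.ofReal ρ2 * ‖normProd (SΩ E) X₁ X₂ X₃ q.1 q.2‖ₑ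
          ∂(κ.prod ((volume : Measure ℝ³).prod volume)) := lintegral_mono hpt
    _ = ENNReal.ofReal ρ2 * ∫⁻ q, ‖normProd (SΩ E) X₁ X₂ X₃ q.1 q.2‖ₑ
          ∂(κ.prod ((volume : Measure ℝ³).prod volume)) := lintegral_const_mul'' _ hnp.enorm
    _ = ENNReal.ofReal ρ2 * ∫⁻ θ, ∫⁻ p, ‖normProd (SΩ E) X₁ X₂ X₃ θ p‖ₑ
          ∂((volume : Measure ℝ³).prod volume) ∂κ := by rw [lintegral_prod _ hnp.enorm]
    _ ≤ ENNReal.ofReal ρ2 * ∫⁻ θ, tripleBound X₁ X₂ X₃ ∂κ :=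
        mul_le_mul' le_rfl (lintegral_mono hinner)
    _ = ENNReal.ofReal ρ2 * (tripleBound X₁ X₂ X₃ * κ univ) := by rw [lintegral_const]
    _ < ∞ := ENNReal.mul_lt_top ENNReal.ofReal_lt_top
        (ENNReal.mul_lt_top (tripleBound_lt_top h₁ h₂ h₃) (measure_lt_top _ _))

/-- `J` is integrable on `Ω`. [cite: Tao2016AveragedNS, §3.6 p. 18] -/
theorem integrable_JW (hwm : Measurable w) (hw1 : ∀ p, ‖w p‖ ≤ 1) [IsFiniteMeasure μ₀]
    (hE : IsRotationFamily E)
    (hF : ContDiff ℝ ((⊤ : ℕ∞) : WithTop ℕ∞) F) (hFc : HasCompactSupport F)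
    (h₁ : FreqIntegrable X₁) (h₂ : FreqIntegrable X₂) (h₃ : FreqIntegrable X₃) :
    Integrable (JW R w E X₁ X₂ X₃) (μ₀.prod (nu F)) := by
  haveI := isFiniteMeasure_nu hF hFc
  have h := (integrable_KWLam μ₀ R w hwm hw1 hE hF hFc h₁ h₂ h₃).integral_prod_left
  exact h

/-- **Step B, integrability**: `c₀ J` is integrable on `Ω`. [cite: Tao2016AveragedNS, §3.6 p. 18] -/
theorem integrable_c0_mul_JW (hwm : Measurable w) (hw1 : ∀ p, ‖w p‖ ≤ 1) [IsFiniteMeasure μ₀]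
    (hE : IsRotationFamily E)
    (hF : ContDiff ℝ ((⊤ : ℕ∞) : WithTop ℕ∞) F) (hFc : HasCompactSupport F)
    (h₁ : FreqIntegrable X₁) (h₂ : FreqIntegrable X₂) (h₃ : FreqIntegrable X₃) :
    Integrable (fun θ => c0 F θ * JW R w E X₁ X₂ X₃ θ) (μ₀.prod (nu F)) :=
  (integrable_JW μ₀ R w hwm hw1 hE hF hFc h₁ h₂ h₃).bdd_mul (measurable_c0 hF hFc).aestronglyMeasurable
    (Eventually.of_forall norm_c0_le_one)

/-- The full integrand `H_ω(v; ξ₁, ξ₂) = f̂(v) e^{2πi φ(v,ω)} K(v; ξ₁, ξ₂) Λ(Y₁, Y₂, Y₃)`.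
[cite: Tao2016AveragedNS, §3.6 p. 18] -/
def HW (R : ℝ) (w : ℝ³ × ℝ³ → ℂ) (E : Fin 3 → (Fin d → ℝ³) → (ℝ³ ≃ₗᵢ[ℝ] ℝ³)) (F : (Fin d → ℝ³) × (ℝ³ × ℝ³) → ℂ)
    (X₁ X₂ X₃ : ℝ³ → ℂ³) (ω : Fin d → ℝ³) (v : Wsp d) (p : ℝ³ × ℝ³) : ℂ :=
  Ghat F v * ((𝐞 (omegaPhase d v ω) : Circle) : ℂ) * (KW d R w v p * LamRot E X₁ X₂ X₃ ω p)

/-- **Step C2**: `|f̂(v)| c₀(ω,v) J(ω,v) = ∫ H_ω(v; ·)`. [cite: Tao2016AveragedNS, §3.6 p. 18] -/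
theorem norm_mul_c0_mul_JW (ω : Fin d → ℝ³) (v : Wsp d) :
    ((‖Ghat F v‖ : ℝ) : ℂ) * (c0 F (ω, v) * JW R w E X₁ X₂ X₃ (ω, v)) =
      ∫ p, HW R w E F X₁ X₂ X₃ ω v p := by
  unfold JW HW
  rw [← mul_assoc, ← integral_const_mul]
  refine integral_congr_ae (Eventually.of_forall fun p => ?_)
  have e : ((‖Ghat F v‖ : ℝ) : ℂ) * c0 F (ω, v) = Ghat F v * ((𝐞 (omegaPhase d v ω) : Circle) : ℂ) := by
    unfold c0
    rw [← mul_assoc, ofReal_norm_mul_phase]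
  simp only
  rw [e]

/-- **Integrability of `H_ω` on `W × ℝ⁶`** (domination by `|f̂(v)| · 2(R⁺+2) |X₁||X₂||X₃|`).
[cite: Tao2016AveragedNS, §3.6 p. 18] -/
theorem integrable_HW (hwm : Measurable w) (hw1 : ∀ p, ‖w p‖ ≤ 1) (hF : ContDiff ℝ ((⊤ : ℕ∞) : WithTop ℕ∞) F) (hFc : HasCompactSupport F)
    (h₁ : FreqIntegrable X₁) (h₂ : FreqIntegrable X₂) (h₃ : FreqIntegrable X₃) (ω : Fin d → ℝ³) :
    Integrable (Function.uncurry (HW R w E F X₁ X₂ X₃ ω))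
      ((volume : Measure (Wsp d)).prod (volume : Measure (ℝ³ × ℝ³))) := by
  have hg : Integrable (fun p : ℝ³ × ℝ³ => 2 * (max R 0 + 2) * normProd E X₁ X₂ X₃ ω p)
      (volume : Measure (ℝ³ × ℝ³)) := (integrable_normProd_at E ω h₁ h₂ h₃).const_mul _
  have hf : Integrable (fun v : Wsp d => ‖Ghat F v‖) := (integrable_Ghat hF hFc).norm
  have hdom := hf.mul_prod hg
  refine hdom.mono' ?_ (Eventually.of_forall fun z => ?_)
  · have hG : Continuous fun z : Wsp d × (ℝ³ × ℝ³) => Ghat F z.1 :=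
      (continuous_Ghat hF hFc).comp continuous_fst
    have hph : Continuous fun z : Wsp d × (ℝ³ × ℝ³) => ((𝐞 (omegaPhase d z.1 ω) : Circle) : ℂ) := by
      have h1 : Continuous fun z : Wsp d × (ℝ³ × ℝ³) => omegaPhase d z.1 ω :=
        (continuous_omegaPhase d).comp (continuous_fst.prodMk continuous_const)
      have h2 := continuous_induced_dom.comp' (Real.continuous_fourierChar.comp h1)
      exact h2
    have hKm := (measurable_KW d R w hwm).aestronglyMeasurable
      (μ := (volume : Measure (Wsp d)).prod (volume : Measure (ℝ³ × ℝ³)))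
    have hL0 := aestronglyMeasurable_LamRot_at E ω h₁.1.1 h₂.1.1 h₃.1.1
    have hL : AEStronglyMeasurable (fun z : Wsp d × (ℝ³ × ℝ³) => LamRot E X₁ X₂ X₃ ω z.2)
        ((volume : Measure (Wsp d)).prod (volume : Measure (ℝ³ × ℝ³))) :=
      hL0.comp_quasiMeasurePreserving Measure.quasiMeasurePreserving_snd
    have h := (hG.mul hph).aestronglyMeasurable.mul (hKm.mul hL)
    exact h
  · change ‖HW R w E F X₁ X₂ X₃ ω z.1 z.2‖ ≤ ‖Ghat F z.1‖ * (2 * (max R 0 + 2) * normProd E X₁ X₂ X₃ ω z.2)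
    unfold HW
    rw [norm_mul, norm_mul, Circle.norm_coe, mul_one]
    exact mul_le_mul_of_nonneg_left (norm_KW_mul_LamRot_le d R w hw1 E X₁ X₂ X₃ ω z.1 z.2)
      (norm_nonneg _)

/-- **Steps C4–C6**: the `v`-integral of `H_ω` reproduces the joint weight (Fourier inversion,
then `χ(ξ₁) χ(ξ₂) = 1` on the support of `F`). [cite: Tao2016AveragedNS, §3.6 p. 18] -/
theorem integral_HW_v (hF : ContDiff ℝ ((⊤ : ℕ∞) : WithTop ℕ∞) F) (hFc : HasCompactSupport F)
    (ω : Fin d → ℝ³) (p : ℝ³ × ℝ³) :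
    ∫ v, HW (Rad hFc) w E F X₁ X₂ X₃ ω v p =
      w p * F (ω, p) * LamRot E X₁ X₂ X₃ ω p := by
  have hH : ∀ v : Wsp d, HW (Rad hFc) w E F X₁ X₂ X₃ ω v p =
      ((𝐞 ⟪v, glue d (ω, p)⟫ : ℂ) * Ghat F v) *
        (w p * (chiC (Rad hFc) p.1 * chiC (Rad hFc) p.2) * LamRot E X₁ X₂ X₃ ω p) := by
    intro v
    unfold HW KW pw
    rw [inner_glue, AddChar.map_add_eq_mul, AddChar.map_add_eq_mul, Circle.coe_mul, Circle.coe_mul]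
    ring
  simp_rw [hH]
  rw [integral_mul_const, fourier_inversion_F hF hFc (ω, p)]
  by_cases hz : F (ω, p) = 0
  · rw [hz]
    ring
  · obtain ⟨e1, e2⟩ := norm_le_Rad_of_ne_zero hFc hz
    rw [chiC, chiC, chi_eq_one e1, chi_eq_one e2]
    push_cast
    ring

/-- **Step C**: for each `ω`, the `ν`-average of `c₀ J` is the joint-weight integrand.
[cite: Tao2016AveragedNS, §3.6 p. 18] -/
theorem inner_identityW (hwm : Measurable w) (hw1 : ∀ p, ‖w p‖ ≤ 1) (hF : ContDiff ℝ ((⊤ : ℕ∞) : WithTop ℕ∞) F) (hFc : HasCompactSupport F)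
    (h₁ : FreqIntegrable X₁) (h₂ : FreqIntegrable X₂) (h₃ : FreqIntegrable X₃) (ω : Fin d → ℝ³) :
    ∫ v, c0 F (ω, v) * JW (Rad hFc) w E X₁ X₂ X₃ (ω, v) ∂(nu F) =
      ∫ p, w p * F (ω, p) * LamRot E X₁ X₂ X₃ ω p := by
  rw [integral_nu hF hFc]
  simp_rw [norm_mul_c0_mul_JW]
  rw [integral_integral_swap (integrable_HW (Rad hFc) w hwm hw1 hF hFc h₁ h₂ h₃ ω)]
  refine integral_congr_ae (Eventually.of_forall fun p => ?_)
  exact integral_HW_v w hF hFc ω p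

/-- **The synthesis identity**: the `Ω`-integral of the frequency-side integrand of the datum is
the joint-weight average ("Inserting this expansion into (3.16), we obtain the desired expansion
(3.15)"). [cite: Tao2016AveragedNS, §3.6 p. 18] -/
theorem integral_freqSideIntegrandW_datum (hwm : Measurable w) (hw1 : ∀ p, ‖w p‖ ≤ 1)
    [IsFiniteMeasure μ₀] (hE : IsRotationFamily E)
    (hF : ContDiff ℝ ((⊤ : ℕ∞) : WithTop ℕ∞) F) (hFc : HasCompactSupport F)
    (h₁ : FreqIntegrable X₁) (h₂ : FreqIntegrable X₂) (h₃ : FreqIntegrable X₃) :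
    ∫ θ, (datum μ₀ hE hF hFc).freqSideIntegrandW w θ X₁ X₂ X₃ ∂(datum μ₀ hE hF hFc).μ =
      jointWeightAverageW μ₀ E w F X₁ X₂ X₃ := by
  haveI := isFiniteMeasure_nu hF hFc
  have hA : ∀ θ, (datum μ₀ hE hF hFc).freqSideIntegrandW w θ X₁ X₂ X₃ =
      c0 F θ * JW (Rad hFc) w E X₁ X₂ X₃ θ :=
    fun θ => freqSideIntegrandW_datum μ₀ w hE hF hFc θ X₁ X₂ X₃
  simp_rw [hA]
  change ∫ θ, c0 F θ * JW (Rad hFc) w E X₁ X₂ X₃ θ ∂(μ₀.prod (nu F)) = _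
  rw [integral_prod _ (integrable_c0_mul_JW μ₀ (Rad hFc) w hwm hw1 hE hF hFc h₁ h₂ h₃)]
  unfold jointWeightAverageW
  refine integral_congr_ae (Eventually.of_forall fun ω => ?_)
  have h := inner_identityW w hwm hw1 hF hFc h₁ h₂ h₃ ω (E := E)
  unfold LamRot at h
  exact h


end IdentityW

end PlaneWave

/-- **Tao 2016, §3.6 (last paragraph), for a general weight**: for every finite measure `μ₀` on
`V = (Fin d → ℝ³)`, every measurable family of rotations `E`, every smooth compactly supported joint
weight `F` and every measurable weight `w` with `|w| ≤ 1`, the (weight-independent) plane-wave datum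
`PlaneWave.datum` is dilation-free and satisfies
`∫_Ω freqSideIntegrandW w = jointWeightAverageW μ₀ E w F` for all `X₁, X₂, X₃ ∈ L¹ ∩ L²`.
[cite: Tao2016AveragedNS, §3.6 p. 18 and Def. 3.4 (3.5)] -/
theorem planeWaveSynthesisW (d : ℕ) (μ₀ : Measure (Fin d → ℝ³)) [IsFiniteMeasure μ₀]
    {E : Fin 3 → (Fin d → ℝ³) → (ℝ³ ≃ₗᵢ[ℝ] ℝ³)} (hE : IsRotationFamily E)
    {w : ℝ³ × ℝ³ → ℂ} (hwm : Measurable w) (hw1 : ∀ p, ‖w p‖ ≤ 1)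
    {F : (Fin d → ℝ³) × (ℝ³ × ℝ³) → ℂ} (hF : ContDiff ℝ ((⊤ : ℕ∞) : WithTop ℕ∞) F)
    (hFc : HasCompactSupport F) :
    (∀ i θ, (PlaneWave.datum μ₀ hE hF hFc).lam i θ = 1) ∧
      ∀ X₁ X₂ X₃ : ℝ³ → ℂ³, FreqIntegrable X₁ → FreqIntegrable X₂ → FreqIntegrable X₃ →
        ∫ θ, (PlaneWave.datum μ₀ hE hF hFc).freqSideIntegrandW w θ X₁ X₂ X₃
            ∂(PlaneWave.datum μ₀ hE hF hFc).μ =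
          jointWeightAverageW μ₀ E w F X₁ X₂ X₃ :=
  ⟨fun _ _ => rfl, fun _ _ _ h₁ h₂ h₃ =>
    PlaneWave.integral_freqSideIntegrandW_datum μ₀ w hwm hw1 hE hF hFc h₁ h₂ h₃⟩

/-- **The plane-wave synthesis for the weight of `B_{η,ρ,0;ξ}` about an arbitrary base triple**:
there is a dilation-free complex averaging datum `𝒟` with
`∫_Ω freqSideIntegrandAt ξ ε₀ = jointWeightAverageW μ₀ E (φ η_ξ) F` on `L¹ ∩ L²` (the tree's
`planeWaveSynthesis_holds` is the `xi0` case). [cite: Tao2016AveragedNS, §3.6 p. 18 and Remark 3.5 p. 20] -/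
theorem planeWaveSynthesisAt (ξ : Fin 3 → ℝ³) (ε₀ : ℝ) (d : ℕ) (μ₀ : Measure (Fin d → ℝ³))
    [IsFiniteMeasure μ₀] {E : Fin 3 → (Fin d → ℝ³) → (ℝ³ ≃ₗᵢ[ℝ] ℝ³)} (hE : IsRotationFamily E)
    {F : (Fin d → ℝ³) × (ℝ³ × ℝ³) → ℂ} (hF : ContDiff ℝ ((⊤ : ℕ∞) : WithTop ℕ∞) F)
    (hFc : HasCompactSupport F) :
    ∃ 𝒟 : ComplexAveragingDatum, (∀ i θ, 𝒟.lam i θ = 1) ∧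
      ∀ X₁ X₂ X₃ : ℝ³ → ℂ³, FreqIntegrable X₁ → FreqIntegrable X₂ → FreqIntegrable X₃ →
        ∫ θ, 𝒟.freqSideIntegrandAt ξ ε₀ θ X₁ X₂ X₃ ∂𝒟.μ =
          jointWeightAverageW μ₀ E (singleScaleWeightAtC ξ ε₀) F X₁ X₂ X₃ := by
  obtain ⟨hlam, h⟩ := planeWaveSynthesisW d μ₀ hE (measurable_singleScaleWeightAtC ξ ε₀)
    (norm_singleScaleWeightAtC_le_one ξ ε₀) hF hFc
  refine ⟨PlaneWave.datum μ₀ hE hF hFc, hlam, fun X₁ X₂ X₃ h₁ h₂ h₃ => ?_⟩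
  simp_rw [ComplexAveragingDatum.freqSideIntegrandAt_eq_W]
  exact h X₁ X₂ X₃ h₁ h₂ h₃

end Literature.Analysis.FluidPDE.Tao2016
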